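import Mathlib
import HarnessLib
import Summits.Ventures.LatticeQCDFlow.Exactness.U1WilsonForceLipschitz

/-!
# `U(1)` rung: the masked Wilson-flow sub-step is `(1 + 8(d−1)|ε|)`-Lipschitz and its booked factor sum `C_e` is `8(d−1)`-Lipschitz (chordal sup metric)

HONEST FRAMING: exact (Metropolis-corrected) sampling algorithms for lattice gauge theory;
figures of merit are autocorrelation/cost numbers at stated couplings and volumes; no
continuum-physics claim.

Venture `LatticeQCDFlow` (cell pub-lqcd), topic `Exactness`; FANOUT row 14 (`eng-flowhmc`, engine
`latflow.fthmc`, family B, `U(1)` rung; sub-step and factor VERBATIM as in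
`exists_layers_u1WilsonFlowLO`).  NEW WORK of the cell over GEN-12's `U1WilsonForceLipschitz`
(`abs_u1FlowField_sub_le`: `Z` is `8(d−1)`-Lipschitz) and row 29's `TopologicalCollar`
(`dist_plaquetteHolonomy_le`, `Circle.dist_mul_mul_le`, `U1.dist_eq_norm_coe`); nothing is cited
as a fact; no number.  Inputs of the Lipschitz transfer of the exact force through one sub-step
(`U1SubstepForceTransfer`).

* `abs_re_sub_re_le_dist` (`|Re z − Re w| ≤ dist(z,w)`; `|Re z| ≤ 1` is row 29's
  `TwoDim.abs_circle_re_le_one`, not restated),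
  `Circle.dist_exp_exp_le` — `dist(e^(is), e^(it)) ≤ |s − t|`;
* **`dist_u1Substep_le`** — `dist(f V, f V') ≤ (1 + 8(d−1)|ε|) · dist(V, V')`;
* **`abs_u1Factor_sub_le`** — `|C_e(V) − C_e(V')| ≤ 8(d−1) · dist(V, V')`.

NOT CLAIMED: sharper constants; `SU(2)`; any number.
-/

noncomputable section

namespace Summit.Ventures.LatticeQCDFlow.Exactness

open Literature.MathematicalPhysics.QuantumFieldTheory Literature.MathematicalPhysics.QuantumLattice
open Summit.Ventures.LatticeQCDFlow.Theory2.Lattice (dist_plaquetteHolonomy_le Circle.dist_mul_mul_le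
  U1.dist_eq_norm_coe)
open scoped BigOperators

variable {d L : ℕ}

section Lipschitz

/-- `|Re z − Re w| ≤ dist(z, w)` on the unit circle (chordal metric). -/
theorem abs_re_sub_re_le_dist (z w : Circle) :
    |((z : Circle) : ℂ).re - ((w : Circle) : ℂ).re| ≤ dist z w := by
  rw [← Complex.sub_re]
  refine (Complex.abs_re_le_norm _).trans_eq ?_
  change _ = dist (z : ℂ) (w : ℂ)
  rw [dist_eq_norm]

/-- `dist(e^(is), e^(it)) ≤ |s − t|` on the unit circle. -/
theorem Circle.dist_exp_exp_le (s t : ℝ) : dist (Circle.exp s) (Circle.exp t) ≤ |s - t| := by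
  rw [U1.dist_eq_norm_coe, Circle.coe_exp, Circle.coe_exp]
  have h : Complex.exp (s * Complex.I) - Complex.exp (t * Complex.I) =
      Complex.exp (t * Complex.I) * (Complex.exp (Complex.I * ((s - t : ℝ) : ℂ)) - 1) := by
    rw [mul_sub, mul_one, ← Complex.exp_add]
    congr 2
    push_cast
    ring
  rw [h, norm_mul, Complex.norm_exp_ofReal_mul_I, one_mul]
  exact (Real.norm_exp_I_mul_ofReal_sub_one_le).trans_eq (Real.norm_eq_abs _)

variable [NeZero L] {X : Type*} [DecidableEq X] (χ : Site d L → X)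

/-- **The masked sub-step is `(1 + 8(d−1)|ε|)`-Lipschitz** (chordal sup metric). -/
theorem dist_u1Substep_le (μ : Fin d) (b : X) (ε : ℝ) (V V' : GaugeConfig d L Circle) :
    dist ((fun (V : GaugeConfig d L Circle) (e : Edge d L) => if e.2 = μ ∧ χ e.1 = b then
          V e * Circle.exp (ε * ∑ ν ∈ Finset.univ.erase e.2,
            (((plaquetteHolonomy V (e.1 - Pi.single ν 1) e.2 ν : Circle) : ℂ).im -
              ((plaquetteHolonomy V e.1 e.2 ν : Circle) : ℂ).im)) else V e) V)
      ((fun (V : GaugeConfig d L Circle) (e : Edge d L) => if e.2 = μ ∧ χ e.1 = b then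
          V e * Circle.exp (ε * ∑ ν ∈ Finset.univ.erase e.2,
            (((plaquetteHolonomy V (e.1 - Pi.single ν 1) e.2 ν : Circle) : ℂ).im -
              ((plaquetteHolonomy V e.1 e.2 ν : Circle) : ℂ).im)) else V e) V') ≤
      (1 + 8 * ((d - 1 : ℕ) : ℝ) * |ε|) * dist V V' := by
  have hD : 0 ≤ dist V V' := dist_nonneg
  refine (dist_pi_le_iff (by positivity)).2 fun e => ?_
  have hlink : dist (V e) (V' e) ≤ dist V V' := dist_le_pi_dist V V' e
  beta_reduce
  by_cases he : e.2 = μ ∧ χ e.1 = b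
  · rw [if_pos he, if_pos he]
    refine (Circle.dist_mul_mul_le _ _ _ _).trans ?_
    have hZ := abs_u1FlowField_sub_le V V' e
    have hexp := (Circle.dist_exp_exp_le (ε * ∑ ν ∈ Finset.univ.erase e.2,
            (((plaquetteHolonomy V (e.1 - Pi.single ν 1) e.2 ν : Circle) : ℂ).im -
              ((plaquetteHolonomy V e.1 e.2 ν : Circle) : ℂ).im))
        (ε * ∑ ν ∈ Finset.univ.erase e.2,
            (((plaquetteHolonomy V' (e.1 - Pi.single ν 1) e.2 ν : Circle) : ℂ).im -
              ((plaquetteHolonomy V' e.1 e.2 ν : Circle) : ℂ).im)))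
    rw [← mul_sub, abs_mul] at hexp
    have h3 : |ε| * |(∑ ν ∈ Finset.univ.erase e.2,
            (((plaquetteHolonomy V (e.1 - Pi.single ν 1) e.2 ν : Circle) : ℂ).im -
              ((plaquetteHolonomy V e.1 e.2 ν : Circle) : ℂ).im)) -
          ∑ ν ∈ Finset.univ.erase e.2,
            (((plaquetteHolonomy V' (e.1 - Pi.single ν 1) e.2 ν : Circle) : ℂ).im -
              ((plaquetteHolonomy V' e.1 e.2 ν : Circle) : ℂ).im)| ≤
        |ε| * (8 * ((d - 1 : ℕ) : ℝ) * dist V V') := mul_le_mul_of_nonneg_left hZ (abs_nonneg ε)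
    nlinarith
  · rw [if_neg he, if_neg he]
    have h8 : 0 ≤ 8 * ((d - 1 : ℕ) : ℝ) * |ε| * dist V V' := by positivity
    nlinarith

omit [DecidableEq X] in
/-- **The booked factor sum `C_e` is `8(d−1)`-Lipschitz**: `|C_e(V) − C_e(V')| ≤ 8(d−1)·dist(V,V')`. -/
theorem abs_u1Factor_sub_le (V V' : GaugeConfig d L Circle) (e : Edge d L) :
    |(∑ ν ∈ Finset.univ.erase e.2,
        (((plaquetteHolonomy V e.1 e.2 ν : Circle) : ℂ).re +
          ((plaquetteHolonomy V (e.1 - Pi.single ν 1) e.2 ν : Circle) : ℂ).re)) -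
      ∑ ν ∈ Finset.univ.erase e.2,
        (((plaquetteHolonomy V' e.1 e.2 ν : Circle) : ℂ).re +
          ((plaquetteHolonomy V' (e.1 - Pi.single ν 1) e.2 ν : Circle) : ℂ).re)| ≤
      8 * ((d - 1 : ℕ) : ℝ) * dist V V' := by
  have hcard : (Finset.univ.erase e.2).card = d - 1 := by
    rw [Finset.card_erase_of_mem (Finset.mem_univ _), Finset.card_univ, Fintype.card_fin]
  rw [← Finset.sum_sub_distrib]
  calc _ ≤ ∑ ν ∈ Finset.univ.erase e.2,
        |(((plaquetteHolonomy V e.1 e.2 ν : Circle) : ℂ).re +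
          ((plaquetteHolonomy V (e.1 - Pi.single ν 1) e.2 ν : Circle) : ℂ).re) -
         (((plaquetteHolonomy V' e.1 e.2 ν : Circle) : ℂ).re +
          ((plaquetteHolonomy V' (e.1 - Pi.single ν 1) e.2 ν : Circle) : ℂ).re)| :=
        Finset.abs_sum_le_sum_abs _ _
    _ ≤ ∑ _ν ∈ Finset.univ.erase e.2, 8 * dist V V' := Finset.sum_le_sum fun ν _ => by
        have h1 := abs_re_sub_re_le_dist (plaquetteHolonomy V e.1 e.2 ν) (plaquetteHolonomy V' e.1 e.2 ν)
        have h2 := abs_re_sub_re_le_dist (plaquetteHolonomy V (e.1 - Pi.single ν 1) e.2 ν)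
          (plaquetteHolonomy V' (e.1 - Pi.single ν 1) e.2 ν)
        have h3 := dist_plaquetteHolonomy_le V V' e.1 e.2 ν
        have h4 := dist_plaquetteHolonomy_le V V' (e.1 - Pi.single ν 1) e.2 ν
        have hre : (((plaquetteHolonomy V e.1 e.2 ν : Circle) : ℂ).re +
            ((plaquetteHolonomy V (e.1 - Pi.single ν 1) e.2 ν : Circle) : ℂ).re) -
            (((plaquetteHolonomy V' e.1 e.2 ν : Circle) : ℂ).re +
              ((plaquetteHolonomy V' (e.1 - Pi.single ν 1) e.2 ν : Circle) : ℂ).re) =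
            (((plaquetteHolonomy V e.1 e.2 ν : Circle) : ℂ).re -
              ((plaquetteHolonomy V' e.1 e.2 ν : Circle) : ℂ).re) +
            (((plaquetteHolonomy V (e.1 - Pi.single ν 1) e.2 ν : Circle) : ℂ).re -
              ((plaquetteHolonomy V' (e.1 - Pi.single ν 1) e.2 ν : Circle) : ℂ).re) := by ring
        rw [hre]
        refine (abs_add_le _ _).trans ?_
        linarith
    _ = 8 * ((d - 1 : ℕ) : ℝ) * dist V V' := by
        rw [Finset.sum_const, nsmul_eq_mul, hcard]; ring

end Lipschitz

end Summit.Ventures.LatticeQCDFlow.Exactness
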